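import Literature.MathematicalPhysics.QuantumFieldTheory.Balaban1983to89.B9Eq328GaugeAction
import Literature.MathematicalPhysics.QuantumFieldTheory.Balaban1983to89.B8Lemma1NonAbelian
import Literature.MathematicalPhysics.QuantumFieldTheory.Balaban1983to89.B5Eq155FlatAveragingCommute

/-!
# `Balaban1983to89.B7Eq44TorusAxialGauge` — T. Bałaban, *Averaging operations for lattice gauge theories*, Commun. Math. Phys. **98** (1985)
# 17–51 [Balaban1985Averaging] (44)–(45) p. 24 and the axial-gauge bond bound of p. 24 l. −2 – p. 25 l. 2, read with T. Bałaban, *Renormalization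
# group approach to lattice gauge field theories. I*, Commun. Math. Phys. **109** (1987) 249–301 [Balaban1987RG1] (1.11)–(1.12) p. 262: SMALL PLAQUETTE
# VARIABLES (AND SMALL HOLONOMIES ALONG THE CLOSED COORDINATE LINES) ⇒ THE AXIAL GAUGE MAKES EVERY BOND VARIABLE SMALL — ON THE PERIODIC LATTICE
# `TSite d P` OF THE pub-balaban NE9 CHAIN (backgrounds `U : Bond d P → 𝔸ˣ`, gauge action `B9Eq328GaugeAction.gaugeU`)

statement-level skeleton of published theorems with citation tags; proofs where landed; nothing here is a claim about the Yang–Mills mass gap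

PDF held: `paper:balaban1985-cmp98-averaging` (journal page = PDF page + 16); pp. 24–25 re-read AS IMAGES by this seat (2026-08-22:
`run/shared/lean/pub/pub-balaban/b2b-balaban-ref1/pages/1985-cmp98-averaging/1985-cmp98-averaging-p008-x2.png`, `…-p009-x2.png`);
`paper:balaban1987-cmp109-rg-i-small-field` p. 262 re-read AS AN IMAGE (`b2b-balaban-ref1/pages/1987-cmp109-rg-I-small-field/1987-cmp109-rg-I-small-field-p014-x2.png`).

THE PRINT (verbatim).  [B7] p. 24: *«We assume that a configuration V defined on a unit lattice Ω′ satisfies |V(∂p) − 1| < α₀, p ⊂ Ω′, (44)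
and α₀ sufficiently small. … let us introduce locally the axial gauge with the initial point y. This means that we take the contours
Γ_{y,x} = [y, (y₁, …, y_{d−1}, x_d)] ∪ … ∪ [(y₁, x₂, …, x_d), x] … and we make a gauge transformation v₀ such that the gauge transformed configuration
V₀ = V^{v₀} satisfies the conditions V₀(Γ_{y,x}) = 1. Such a gauge transformation can be easily found because V₀(Γ_{y,x}) = V^{v₀}(Γ_{y,x}) =
v₀(y)V(Γ_{y,x})v₀⁻¹(x) = 1 implies v₀(x) = v₀(y)V(Γ_{y,x}); thus v₀ is determined uniquely if v₀(y) is given. Of course, we have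
|V₀(∂p) − 1| = |V(∂p) − 1| < α₀ … (45)»*; p. 24 l. −2 – p. 25 l. 2: *«The conditions V₀(Γ_{y,x}) = 1 imply V₀(x, x + e₁) = 1, |V₀(x, x + e₂) − 1| <
|x₁ − y₁|α₀, |V₀(x, x + e₃) − 1| < (|x₁ − y₁| + |x₂ − y₂|)α₀, …, |V₀(x, x + e_μ) − 1| < (|x₁ − y₁| + … + |x_{μ−1} − y_{μ−1}|)α₀, μ = 2, …, d, for x in
the neighborhood of y»*; p. 25: *«for b ⊂ Δ(p′) we have |V₀,b − 1| < |b₋ − y|α₀ ≦ dLα₀»*.  [Balaban1987RG1] p. 262: *«The space U^c_j(X, α₀, α₁, γ₀) is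
a union of orbits [(U, J)] determined by configurations U, J satisfying the four conditions written below. (i) U = U′U, U has values in the group G,
|∂U − 1| < α₀ξ² on X, (1.11) for each cube □ ⊂ X of a size O(1)LM there exists a G-valued gauge transformation u defined on □ and such, that
U^u = exp iξA, |A|, |∇^ξA| < O(1)LMBα₀ on □, (1.12)»*.

WHY THIS FILE (cell context).  Every small-field theorem of the pub-balaban NE9 chain ([B9] Thm 3.11 `B9Thm311SmallFieldClosed`, `B9Eq335SmallBondsData`,
the `Support/NE9CurChart*` leaves) displays its torus background through the bond-wise smallness `‖U(b) − 1‖ ≤ ε` IN THE GIVEN GAUGE; the gauge-orbit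
files of this lineage (`B9Thm311GaugeOrbitClosed`, `Support/NE9CurChart*GaugeOrbit`, gen 60) extend them to `V = U^g` on the `U1`-orbit of that ball.
Print's regularity class ((1.11)–(1.12), [B9] (3.35)) is instead «plaquette variables small, and on each cube SOME gauge makes the bond variables small».
The BINDER-row owner named the passage «small plaquette variables ⇒ a gauge with small bond variables» as successor item (iii) of this lineage
(journal l.43195).  ON A TORUS the naive form of that passage is FALSE: the holonomies along the `d` closed coordinate lines are gauge-COVARIANT and
need not be small when all plaquette variables are (the sibling file `B7Eq45TorusGaugeOrbit` proves the no-go).  This file proves the form that holds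
when the cube is the whole periodic lattice of the chain's E162 model: plaquettes AND closed lines small ⇒ the axial gauge of p. 24 (rooted at the
origin, on the box `[0, P−1]^d` of representatives, descended to the torus) makes EVERY bond variable small, wrapping bonds included.

WHAT IS DEFINED AND PROVED (sorry-free; no `Prop` placeholder; the non-abelian Stokes ∕ ladder induction is the tree's `B7Prop1Explicit` ∕
`B8Lemma1NonAbelian`, used BY NAME).
* §1 lattice dictionary (bookkeeping on the tree's `liftSite` ∕ `perSite` ∕ `perCfg`): `periodVec_single_one`, `perSite_add_period`, `hol_perCfg_add_period`,
  `liftSite_nonneg`, `liftSite_add_e_le`, `liftSite_shift_of_lt` (no wrap: `liftSite (x + e_μ) = liftSite x + e_μ`), `liftSite_add_e_eq_of_wrap` (wrap: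
  `liftSite x + e_μ = liftSite (x + e_μ) + P_μ e_μ`), `liftSite_shift_apply_of_wrap`, `lowPart_liftSite_shift`, `perCfg_liftSite`; the plaquette dictionary
  `hol_perCfg_plaqWord` (`Ũ(∂p_{κμ}(z)) = U(∂p)` at `perSite z`, `κ < μ`), `hol_perCfg_plaqWord_of_gt` (the inverse for `μ < κ`), and
  **`plaqSmall_perCfg`**: the torus hypothesis `‖U(∂p) − 1‖ ≤ δ` (all plaquettes) gives (44) for EVERY unit plaquette of `ℤ^d` for `Ũ = perCfg P U`.
* §2 **`axialGaugeT P U x := axialFn Ũ 0 (liftSite x)`** (p. 24's `v₀` for the periodic extension, root `0`, read on the torus) and **`lineHolT P U x μ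
  := Ũ([x̃, x̃ + P_μ e_μ])`** (the holonomy of the CLOSED straight line through `x` in direction `μ`); `perCfg_gaugeU'` ((3.28) read on `ℤ^d`, any period
  vector), `lineHolT_gaugeU` (closed lines are CONJUGATED: `(U^g)(C_{x,μ}) = g(x)U(C_{x,μ})g(x)⁻¹`).
* §3 THE TWO IDENTITIES: `gaugeU_axialGaugeT_of_lt` — at a non-wrapping bond the torus gauge action IS the `ℤ^d` axial gauge `V = Ũ^{v₀}` of the tree;
  **`gaugeU_axialGaugeT_of_wrap`** — at a wrapping bond `(x, μ)`, `x_μ = P_μ − 1`, with `y′ = liftSite (x + e_μ)`: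
  `U^g(x, μ) = (V([y′, y′ + (P_μ − 1)e_μ]))⁻¹ · (v₀(y′)·Ũ(C_{y′,μ})·v₀(y′)⁻¹)` (from `B7Prop1Explicit.hol_gaugeAct`, `hol_seg_succ` — pure group algebra).
* §4 THE BOUNDS (`𝔸` a normed ring with `‖1‖ = 1`, `U(b) ∈ U1`): **`norm_gaugeU_axialGaugeT_sub_one_le_of_lt`** — `‖U^g(x,μ) − 1‖ ≤ |lowPart μ x̃|₁·δ =
  (Σ_{κ<μ} x_κ)·δ` (p. 24 l. −2 verbatim, `B8Lemma1NonAbelian.axial_bond_bound_sharp` BY NAME); **`norm_gaugeU_axialGaugeT_sub_one_le_of_wrap`** —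
  `≤ (P_μ − 1)·(Σ_{κ<μ} x_κ)·δ + θ` where `θ` bounds `‖U(C_{x+e_μ, μ}) − 1‖`; **`norm_gaugeU_axialGaugeT_sub_one_le`** — the UNIFORM form
  `‖U^g(b) − 1‖ ≤ d(N − 1)²·δ + θ` for `P_i ≤ N`, all plaquettes `≤ δ`, all closed lines `≤ θ`; `axialGaugeT_mem_U1`, `gaugeU_mem_U1`.
MODEL / DECLARED READINGS.  (M1) the chain's encodings verbatim (`TSite`, `Bond`, `shift`, `plaqHolU`, `gaugeU`, `perCfg`, `U1`); a general period vector
`P` (the chain instantiates `P := fineP L m`).  (M2) hypotheses: unit-bounded bond variables, ALL plaquette variables `δ`-close to `1`, ALL closed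
coordinate lines `θ`-close to `1` — the second is NOT in print (print's cube does not wrap; here the cube is the torus) and cannot be dropped (sibling
no-go).  (M3) constants explicit, polynomial in the period; print's `|b₋ − y|α₀ ≦ dLα₀` becomes `d(N−1)δ` (non-wrapping) and `d(N−1)²δ + θ` (wrapping).
NOT HERE: the converse (45) `|V^g(∂p) − 1| = |V(∂p) − 1|`, unitarity of the gauge, the orbit packaging and the no-go (sibling `B7Eq45TorusGaugeOrbit`);
anything of [B7] Props 1–4, [B9] Thms 3.1–3.11, [I]; the logarithm `V₀,b = e^{iA_b}`.
HONEST SCOPE.  [folklore] finite-lattice group bookkeeping realising print's «there exists a gauge transformation u on □» on the E162 torus; NOT summit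
progress (cell pub-balaban: NE9 NOT PRINTED / NOT PROVED; «NE9 ⇐ the named binders»; spine PROVED 0/9; HONEST DEPENDENCY: continuum YM on T⁴ ⇐ BetaPertH ∧
nine spine estimates (0/9 proved); BetaPertH ⇐ (D1) ∧ (D4) ∧ CAP+tail; G-an2-4 gates asym, D1 and NE2/3/4).  Unit `b2b-balaban-t4-ne9-formalise-leaf-03`
(NE9 crux-team leaf prover, gen 61), INTENT I-ne9leaf03-g61-1 file (A1); NEW file; modifies nothing.  Net new unproved facts: 0.
-/

noncomputable section

namespace Literature.MathematicalPhysics.QuantumFieldTheory.Balaban1983to89.B7Eq44TorusAxialGauge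

open B4Sect5Torus (TSite)
open B9SectCLatticeCarrier (Bond shift shift_apply_val shift_apply_ne)
open B7Prop1Explicit (e e_apply hol hol_cons hol_nil stepHol stepHol_true stepHol_false seg disp disp_seg treeWord gaugeAct axialFn U1 mem_U1
  plaqWord l1 Letter hol_gaugeAct hol_seg_succ hol_mem axialFn_mem gaugeAct_mem norm_inv_sub_one_le norm_units_conj_sub_one_le)
open B8Lemma1NonAbelian (lowPart lowPart_apply lowPart_add lowPart_zsmul_e_of_le zsmul_e_apply axial_bond_bound_sharp seg_walk)
open B9Eq315QTorus (perSite perCfg perCfg_apply)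
open B9Eq315QTorusOnto (liftSite periodVec perSite_liftSite perSite_add_periodVec hol_perCfg_add_periodVec)
open B5Eq155FlatAveragingCommute (shift_perSite perSite_liftSite_add_e liftSite_shift_add_periodVec)
open B9Eq310DeltaPrime (plaqHolU)
open B9Eq328GaugeAction (gaugeU gaugeU_apply gaugeU_apply_dir)

variable {d : ℕ} (P : Fin d → ℕ)

/-! ## §1 Lattice dictionary: representatives, one period, the wrap, plaquettes read on `ℤ^d` -/

section Lattice

/-- One period in direction `μ` is the period vector of the multi-index `δ_μ`. [cite: Balaban1985Averaging, (1) p.17] -/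
theorem periodVec_single_one (μ : Fin d) : periodVec P (Pi.single μ 1) = (P μ : ℤ) • e μ := by
  funext i; rw [zsmul_e_apply]; by_cases h : i = μ
  · subst h; simp [periodVec]
  · simp [periodVec, h]

/-- The representative of a torus site has non-negative coordinates. [cite: Balaban1985Averaging, (1) p.17] -/
theorem liftSite_nonneg (x : TSite d P) : (0 : B7Prop1Explicit.Site d) ≤ liftSite x := fun i => by
  simp only [liftSite, Pi.zero_apply]; positivity

/-- The representative box is `[0, P − 1]^d`: `liftSite x + e_μ ≤ P` coordinatewise. [cite: Balaban1985Averaging, (1) p.17] -/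
theorem liftSite_add_e_le (x : TSite d P) (μ : Fin d) : liftSite x + e μ ≤ fun i => (P i : ℤ) := fun i => by
  simp only [liftSite, Pi.add_apply, e_apply]
  have := (x i).isLt
  split_ifs <;> omega

variable [∀ i, NeZero (P i)]

/-- Reading on the torus is invariant under one period in direction `μ`. [cite: Balaban1985Averaging, (1) p.17] -/
theorem perSite_add_period (z : B7Prop1Explicit.Site d) (μ : Fin d) : perSite P (z + (P μ : ℤ) • e μ) = perSite P z := by
  rw [← periodVec_single_one, perSite_add_periodVec]

variable {G : Type*} [Group G]

/-- Holonomies of the periodic extension are invariant under one period in direction `μ`. [cite: Balaban1985Averaging, (9) p.18, (1) p.17] -/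
theorem hol_perCfg_add_period (U : Bond d P → G) (z : B7Prop1Explicit.Site d) (μ : Fin d) (w : List (Letter d)) :
    hol (perCfg P U) (z + (P μ : ℤ) • e μ) w = hol (perCfg P U) z w := by
  rw [← periodVec_single_one]
  exact hol_perCfg_add_periodVec P U _ z w

omit [Group G] in
/-- The periodic extension at a representative is the torus bond variable. [cite: Balaban1985Averaging, (1) p.17] -/
@[simp] theorem perCfg_liftSite (U : Bond d P → G) (x : TSite d P) (κ : Fin d) : perCfg P U (liftSite x) κ = U (x, κ) := by
  rw [perCfg_apply, perSite_liftSite]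

omit [∀ i, NeZero (P i)] in
/-- NO WRAP: for `x_μ + 1 < P_μ` the representative of `x + e_μ` is `liftSite x + e_μ`. [cite: Balaban1985Averaging, (1) p.17] -/
theorem liftSite_shift_of_lt (x : TSite d P) (μ : Fin d) (h : (x μ : ℕ) + 1 < P μ) : liftSite (shift μ x) = liftSite x + e μ := by
  have := liftSite_shift_add_periodVec P x μ
  rw [Nat.div_eq_of_lt h, Nat.cast_zero, Pi.single_zero] at this
  have hz : periodVec P (0 : B7Prop1Explicit.Site d) = 0 := by funext i; simp [periodVec]
  rwa [hz, add_zero] at this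

/-- WRAP: for `x_μ + 1 = P_μ` the representative of `x + e_μ` is `liftSite x + e_μ − P_μ e_μ`. [cite: Balaban1985Averaging, (1) p.17] -/
theorem liftSite_add_e_eq_of_wrap (x : TSite d P) (μ : Fin d) (h : (x μ : ℕ) + 1 = P μ) :
    liftSite x + e μ = liftSite (shift μ x) + (P μ : ℤ) • e μ := by
  have := liftSite_shift_add_periodVec P x μ
  rw [h, Nat.div_self (NeZero.pos (P μ)), Nat.cast_one, periodVec_single_one] at this
  exact this.symm

omit [∀ i, NeZero (P i)] in
/-- WRAP: the `μ`-coordinate of the representative of `x + e_μ` is `0`. [cite: Balaban1985Averaging, (1) p.17] -/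
theorem liftSite_shift_apply_of_wrap (x : TSite d P) (μ : Fin d) (h : (x μ : ℕ) + 1 = P μ) : liftSite (shift μ x) μ = 0 := by
  simp only [liftSite, shift_apply_val, h, Nat.mod_self, Nat.cast_zero]

omit [∀ i, NeZero (P i)] in
/-- The coordinates below `μ` of the representative do not see the step `+e_μ` (the tree contour `Γ_{y,x}` of p. 24 changes them last). [cite: Balaban1985Averaging, p.24, (1) p.17] -/
theorem lowPart_liftSite_shift (x : TSite d P) (μ : Fin d) : lowPart μ (liftSite (shift μ x)) = lowPart μ (liftSite x) := by
  funext κ; simp only [lowPart_apply, liftSite]; split_ifs with hκ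
  · rw [shift_apply_ne (ne_of_lt hκ)]
  · rfl

/-- **The plaquette dictionary**: the `ℤ^d` plaquette holonomy of the periodic extension at `z`, directions `κ < μ`, IS the torus plaquette variable
`U(∂p)` of `B9Eq310DeltaPrime` at `perSite z`. [cite: Balaban1985Averaging, (9) p.18; Balaban1985BackgroundPropagators, (3.1) p.390] -/
theorem hol_perCfg_plaqWord {𝔸 : Type*} [Ring 𝔸] (U : Bond d P → 𝔸ˣ) (z : B7Prop1Explicit.Site d) {κ μ : Fin d} (h : κ < μ) :
    hol (perCfg P U) z (plaqWord κ μ) = plaqHolU U (perSite P z, ⟨(κ, μ), h⟩) := by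
  have h2 : z + e κ + e μ - e κ = z + e μ := by abel
  have h3 : z + e κ + e μ + -e κ - e μ = z := by abel
  simp only [plaqWord, hol_cons, hol_nil, mul_one, stepHol_true, stepHol_false, Letter.vec_true, Letter.vec_false, h2, h3, perCfg_apply,
    ← shift_perSite, plaqHolU, mul_assoc]

/-- The plaquette word with the directions exchanged is the INVERSE plaquette variable. [cite: Balaban1985Averaging, (9) p.18] -/
theorem hol_perCfg_plaqWord_of_gt {𝔸 : Type*} [Ring 𝔸] (U : Bond d P → 𝔸ˣ) (z : B7Prop1Explicit.Site d) {κ μ : Fin d} (h : μ < κ) :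
    hol (perCfg P U) z (plaqWord κ μ) = (plaqHolU U (perSite P z, ⟨(μ, κ), h⟩))⁻¹ := by
  have h2 : z + e κ + e μ - e κ = z + e μ := by abel
  have h3 : z + e κ + e μ + -e κ - e μ = z := by abel
  simp only [plaqWord, hol_cons, hol_nil, mul_one, stepHol_true, stepHol_false, Letter.vec_true, Letter.vec_false, h2, h3, perCfg_apply,
    ← shift_perSite, plaqHolU, mul_inv_rev, inv_inv, mul_assoc]

/-- **(44) FOR THE PERIODIC EXTENSION**: if every torus plaquette variable is `δ`-close to `1` (unit-bounded bond variables), then EVERY unit plaquette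
holonomy of `Ũ = perCfg P U` on `ℤ^d`, in either orientation, is `δ`-close to `1`. [cite: Balaban1985Averaging, (44) p.24] -/
theorem plaqSmall_perCfg {𝔸 : Type*} [NormedRing 𝔸] [NormOneClass 𝔸] {U : Bond d P → 𝔸ˣ} (hU : ∀ b, U b ∈ U1 𝔸) {δ : ℝ}
    (hδ : ∀ p : B9SectCLatticeCarrier.Plaq d P, ‖(plaqHolU U p : 𝔸) - 1‖ ≤ δ) (z : B7Prop1Explicit.Site d) (κ μ : Fin d) (hκμ : κ ≠ μ) :
    ‖((hol (perCfg P U) z (plaqWord κ μ) : 𝔸ˣ) : 𝔸) - 1‖ ≤ δ := by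
  rcases lt_or_gt_of_ne hκμ with h | h
  · rw [hol_perCfg_plaqWord P U z h]; exact hδ _
  · rw [hol_perCfg_plaqWord_of_gt P U z h]
    have hmem : hol (perCfg P U) z (plaqWord μ κ) ∈ U1 𝔸 := hol_mem (fun x ν => hU _) _ _
    rw [hol_perCfg_plaqWord P U z h] at hmem
    exact (norm_inv_sub_one_le hmem).trans (hδ _)

/-- (44) on `ℤ^d` in the tree's LOCAL form `PlaqSmall`, on any order interval. [cite: Balaban1985Averaging, (44) p.24] -/
theorem plaqSmall_perCfg' {𝔸 : Type*} [NormedRing 𝔸] [NormOneClass 𝔸] {U : Bond d P → 𝔸ˣ} (hU : ∀ b, U b ∈ U1 𝔸) {δ : ℝ}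
    (hδ : ∀ p : B9SectCLatticeCarrier.Plaq d P, ‖(plaqHolU U p : 𝔸) - 1‖ ≤ δ) (lo hi : B7Prop1Explicit.Site d) :
    B8Lemma1NonAbelian.PlaqSmall (perCfg P U) lo hi δ :=
  fun z κ μ hκμ _ _ => plaqSmall_perCfg P hU hδ z κ μ hκμ

end Lattice

/-! ## §2 The torus axial gauge and the closed coordinate lines -/

section Defs

variable [∀ i, NeZero (P i)] {G : Type*} [Group G]

/-- **THE AXIAL GAUGE OF p. 24 ON THE TORUS**: `v₀(x) = Ũ(Γ_{0,x̃})`, the tree holonomy of the periodic extension from the origin to the representative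
`x̃ = liftSite x ∈ [0, P−1]^d` (`B7Prop1Explicit.axialFn` BY NAME), read as a gauge function on `TSite d P`. [cite: Balaban1985Averaging, p.24] -/
def axialGaugeT (U : Bond d P → G) : TSite d P → G := fun x => axialFn (perCfg P U) 0 (liftSite x)

/-- Unfolding. [cite: Balaban1985Averaging, p.24] -/
theorem axialGaugeT_apply (U : Bond d P → G) (x : TSite d P) : axialGaugeT P U x = axialFn (perCfg P U) 0 (liftSite x) := rfl

/-- **THE CLOSED COORDINATE LINE** `C_{x,μ}`: the holonomy `Ũ([x̃, x̃ + P_μ e_μ])` of the `P_μ` consecutive bonds in direction `μ` starting at `x` — a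
closed contour of the torus, not of print's cube. [cite: Balaban1985Averaging, (9) p.18] -/
def lineHolT (U : Bond d P → G) (x : TSite d P) (μ : Fin d) : G := hol (perCfg P U) (liftSite x) (seg μ (P μ))

/-- Unfolding. [cite: Balaban1985Averaging, (9) p.18] -/
theorem lineHolT_apply (U : Bond d P → G) (x : TSite d P) (μ : Fin d) : lineHolT P U x μ = hol (perCfg P U) (liftSite x) (seg μ (P μ)) := rfl

/-- **(3.28) READ ON `ℤ^d`** (any period vector): the periodic extension of `U^g` is the [B7] (8) gauge transform of `Ũ` by `g ∘ perSite`.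
[cite: Balaban1985BackgroundPropagators, (3.28) p.395; Balaban1985Averaging, (8) p.18] -/
theorem perCfg_gaugeU' (g : TSite d P → G) (U : Bond d P → G) :
    perCfg P (gaugeU g U) = gaugeAct (fun z => g (perSite P z)) (perCfg P U) := by
  funext z κ
  rw [perCfg_apply, gaugeU_apply_dir, shift_perSite]
  rfl

/-- **CLOSED LINES ARE CONJUGATED BY THE GAUGE**: `(U^g)(C_{x,μ}) = g(x)·U(C_{x,μ})·g(x)⁻¹` ([B7] (8) along a contour that closes on the torus).
[cite: Balaban1985Averaging, (8)–(9) p.18] -/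
theorem lineHolT_gaugeU (g : TSite d P → G) (U : Bond d P → G) (x : TSite d P) (μ : Fin d) :
    lineHolT P (gaugeU g U) x μ = g x * lineHolT P U x μ * (g x)⁻¹ := by
  rw [lineHolT_apply, lineHolT_apply, perCfg_gaugeU', hol_gaugeAct, disp_seg, perSite_add_period, perSite_liftSite]

end Defs

/-! ## §3 The two identities: non-wrapping bonds, wrapping bonds -/

section Identities

variable [∀ i, NeZero (P i)] {G : Type*} [Group G] (U : Bond d P → G)

/-- **NON-WRAPPING BONDS**: for `x_μ + 1 < P_μ` the torus gauge action of `axialGaugeT` at `(x, μ)` IS the tree's `ℤ^d` axial gauge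
`V = Ũ^{v₀}` at `(x̃, μ)`. [cite: Balaban1985Averaging, p.24; Balaban1985BackgroundPropagators, (3.28) p.395] -/
theorem gaugeU_axialGaugeT_of_lt (x : TSite d P) (μ : Fin d) (h : (x μ : ℕ) + 1 < P μ) :
    gaugeU (axialGaugeT P U) U (x, μ) = gaugeAct (axialFn (perCfg P U) 0) (perCfg P U) (liftSite x) μ := by
  rw [gaugeU_apply_dir, axialGaugeT_apply, axialGaugeT_apply, liftSite_shift_of_lt P x μ h]
  show _ = _ * perCfg P U (liftSite x) μ * _
  rw [perCfg_liftSite]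

/-- **WRAPPING BONDS**: for `x_μ + 1 = P_μ`, with `y′ = liftSite (x + e_μ)` (whose `μ`-coordinate is `0`), `V = Ũ^{v₀}` the `ℤ^d` axial gauge and
`C_{x+e_μ, μ}` the closed line: `U^g(x, μ) = (V([y′, y′ + (P_μ − 1)e_μ]))⁻¹ · (v₀(y′)·Ũ(C)·v₀(y′)⁻¹)` — the wrapping bond variable is the inverse
holonomy of the OPEN line of `P_μ − 1` axial-gauge bonds times the conjugated closed line. [cite: Balaban1985Averaging, (8)–(9) p.18, p.24] -/
theorem gaugeU_axialGaugeT_of_wrap (x : TSite d P) (μ : Fin d) (h : (x μ : ℕ) + 1 = P μ) :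
    gaugeU (axialGaugeT P U) U (x, μ) =
      (hol (gaugeAct (axialFn (perCfg P U) 0) (perCfg P U)) (liftSite (shift μ x)) (seg μ ((P μ - 1 : ℕ) : ℤ)))⁻¹ *
        (axialFn (perCfg P U) 0 (liftSite (shift μ x)) * lineHolT P U (shift μ x) μ * (axialFn (perCfg P U) 0 (liftSite (shift μ x)))⁻¹) := by
  set Ut := perCfg P U with hUt
  set g₀ := axialFn Ut 0 with hg₀
  set V := gaugeAct g₀ Ut with hV
  set y' := liftSite (shift μ x) with hy'
  have hP1 : ((P μ - 1 : ℕ) : ℤ) = (P μ : ℤ) - 1 := Nat.cast_pred (NeZero.pos (P μ))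
  have ha : liftSite x + e μ = y' + (P μ : ℤ) • e μ := liftSite_add_e_eq_of_wrap P x μ h
  have hb : liftSite x = y' + ((P μ : ℤ) - 1) • e μ := by
    rw [sub_smul, one_smul, ← add_sub_assoc, ← ha, add_sub_cancel_right]
  have hc : hol V y' (seg μ (P μ)) = g₀ y' * lineHolT P U (shift μ x) μ * (g₀ (y' + (P μ : ℤ) • e μ))⁻¹ := by
    rw [hV, hol_gaugeAct, disp_seg, lineHolT_apply]
  have hd : hol V y' (seg μ (P μ)) = hol V y' (seg μ ((P μ : ℤ) - 1)) * V (liftSite x) μ := by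
    have := hol_seg_succ V y' μ ((P μ : ℤ) - 1)
    rwa [sub_add_cancel, ← hb] at this
  have he : V (liftSite x) μ = g₀ (liftSite x) * U (x, μ) * (g₀ (y' + (P μ : ℤ) • e μ))⁻¹ := by
    show g₀ _ * Ut _ μ * (g₀ (liftSite x + e μ))⁻¹ = _
    rw [ha, hUt, perCfg_liftSite]
  have hc' : g₀ (y' + (P μ : ℤ) • e μ) = (hol V y' (seg μ (P μ)))⁻¹ * g₀ y' * lineHolT P U (shift μ x) μ := by
    rw [hc]; group
  rw [gaugeU_apply_dir, axialGaugeT_apply, axialGaugeT_apply, hP1, ← hUt, ← hg₀, ← hy']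
  calc g₀ (liftSite x) * U (x, μ) * (g₀ y')⁻¹ = V (liftSite x) μ * g₀ (y' + (P μ : ℤ) • e μ) * (g₀ y')⁻¹ := by rw [he]; group
    _ = V (liftSite x) μ * ((hol V y' (seg μ (P μ)))⁻¹ * g₀ y' * lineHolT P U (shift μ x) μ) * (g₀ y')⁻¹ := by rw [hc']
    _ = _ := by rw [hd]; group

end Identities

/-! ## §4 The bounds: unit-bounded letters, small plaquettes, small closed lines -/

section Bounds

variable [∀ i, NeZero (P i)] {𝔸 : Type*} [NormedRing 𝔸] [NormOneClass 𝔸] {U : Bond d P → 𝔸ˣ} (hU : ∀ b, U b ∈ U1 𝔸)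

include hU in
/-- The axial gauge is unit-bounded (a product of unit-bounded bond variables). [cite: Balaban1985Averaging, p.24] -/
theorem axialGaugeT_mem_U1 (x : TSite d P) : axialGaugeT P U x ∈ U1 𝔸 := axialFn_mem (fun _ _ => hU _) 0 _

omit [∀ i, NeZero (P i)] in
include hU in
/-- A gauged field is unit-bounded when the field and the gauge are (`U1` is a subgroup). [cite: Balaban1985BackgroundPropagators, (3.28) p.395] -/
theorem gaugeU_mem_U1 {g : TSite d P → 𝔸ˣ} (hg : ∀ x, g x ∈ U1 𝔸) (b : Bond d P) : gaugeU g U b ∈ U1 𝔸 := by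
  rw [gaugeU_apply]
  exact (U1 𝔸).mul_mem ((U1 𝔸).mul_mem (hg _) (hU b)) ((U1 𝔸).inv_mem (hg _))

variable {δ : ℝ} (hδ : ∀ p : B9SectCLatticeCarrier.Plaq d P, ‖(plaqHolU U p : 𝔸) - 1‖ ≤ δ)

include hU hδ in
/-- **p. 24 l. −2 ON THE TORUS, NON-WRAPPING BONDS**: `‖U^g(x, μ) − 1‖ ≤ (Σ_{κ<μ} x_κ)·δ` — print's `|V₀(x, x + e_μ) − 1| < (|x₁ − y₁| + … +
|x_{μ−1} − y_{μ−1}|)α₀` at `y = 0`, `x = x̃` (`B8Lemma1NonAbelian.axial_bond_bound_sharp` BY NAME on the box `[0, P]`). [cite: Balaban1985Averaging, pp.24–25] -/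
theorem norm_gaugeU_axialGaugeT_sub_one_le_of_lt (x : TSite d P) (μ : Fin d) (h : (x μ : ℕ) + 1 < P μ) :
    ‖((gaugeU (axialGaugeT P U) U (x, μ) : 𝔸ˣ) : 𝔸) - 1‖ ≤ l1 (lowPart μ (liftSite x)) * δ := by
  rw [gaugeU_axialGaugeT_of_lt P U x μ h]
  have := axial_bond_bound_sharp (perCfg P U) (fun z κ => hU _) (plaqSmall_perCfg' P hU hδ 0 fun i => (P i : ℤ)) 0 (liftSite x) μ le_rfl
    (liftSite_nonneg P x) (liftSite_add_e_le P x μ)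
  rwa [sub_zero] at this

include hU hδ in
/-- The same bound along the open line `[y′, y′ + (P_μ − 1)e_μ]` of axial-gauge bonds above a wrapping bond: each of its `P_μ − 1` bonds has the SAME
coordinates below `μ`, hence `‖V([y′, y′ + (P_μ−1)e_μ]) − 1‖ ≤ (P_μ − 1)·(Σ_{κ<μ} x_κ)·δ` (`B8Lemma1NonAbelian.seg_walk`). [cite: Balaban1985Averaging, pp.24–25] -/
theorem norm_hol_openLine_sub_one_le (x : TSite d P) (μ : Fin d) (h : (x μ : ℕ) + 1 = P μ) :
    ‖((hol (gaugeAct (axialFn (perCfg P U) 0) (perCfg P U)) (liftSite (shift μ x)) (seg μ ((P μ - 1 : ℕ) : ℤ)) : 𝔸ˣ) : 𝔸) - 1‖ ≤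
      (P μ - 1 : ℕ) * (l1 (lowPart μ (liftSite x)) * δ) := by
  have hUt : ∀ z κ, perCfg P U z κ ∈ U1 𝔸 := fun z κ => hU _
  refine seg_walk _ (gaugeAct_mem hUt (axialFn_mem hUt 0)) _ μ (P μ - 1) fun j hj => ?_
  have hlow : lowPart μ (liftSite (shift μ x) + (j : ℤ) • e μ - 0) = lowPart μ (liftSite x) := by
    rw [sub_zero, lowPart_add, lowPart_zsmul_e_of_le le_rfl, add_zero, lowPart_liftSite_shift]
  have hle : liftSite (shift μ x) + (j : ℤ) • e μ + e μ ≤ fun i => (P i : ℤ) := by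
    intro i
    simp only [Pi.add_apply, zsmul_e_apply, e_apply]
    by_cases hi : i = μ
    · subst hi; rw [if_pos rfl, if_pos rfl, liftSite_shift_apply_of_wrap P x i h]; omega
    · rw [if_neg hi, if_neg hi, add_zero, add_zero]; simp only [liftSite]; exact_mod_cast ((shift μ x) i).isLt.le
  have h0 : (0 : B7Prop1Explicit.Site d) ≤ liftSite (shift μ x) + (j : ℤ) • e μ := fun i => by
    simp only [Pi.add_apply, zsmul_e_apply, Pi.zero_apply]
    have := liftSite_nonneg P (shift μ x) i
    simp only [Pi.zero_apply] at this
    split_ifs <;> omega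
  have := axial_bond_bound_sharp (perCfg P U) hUt (plaqSmall_perCfg' P hU hδ 0 fun i => (P i : ℤ)) 0 _ μ le_rfl h0 hle
  rwa [hlow] at this

include hU hδ in
/-- **WRAPPING BONDS**: `‖U^g(x, μ) − 1‖ ≤ (P_μ − 1)·(Σ_{κ<μ} x_κ)·δ + θ` for `x_μ + 1 = P_μ`, where `θ` bounds the closed line `‖U(C_{x+e_μ,μ}) − 1‖`
(the identity `gaugeU_axialGaugeT_of_wrap`, `‖a b − 1‖ ≤ ‖a − 1‖ + ‖b − 1‖` for `‖a‖ ≤ 1`, `‖v X v⁻¹ − 1‖ ≤ ‖X − 1‖` on `U1`).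
[cite: Balaban1985Averaging, (8)–(9) p.18, pp.24–25] -/
theorem norm_gaugeU_axialGaugeT_sub_one_le_of_wrap (x : TSite d P) (μ : Fin d) (h : (x μ : ℕ) + 1 = P μ) {θ : ℝ}
    (hθ : ‖((lineHolT P U (shift μ x) μ : 𝔸ˣ) : 𝔸) - 1‖ ≤ θ) :
    ‖((gaugeU (axialGaugeT P U) U (x, μ) : 𝔸ˣ) : 𝔸) - 1‖ ≤ (P μ - 1 : ℕ) * (l1 (lowPart μ (liftSite x)) * δ) + θ := by
  have hUt : ∀ z κ, perCfg P U z κ ∈ U1 𝔸 := fun z κ => hU _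
  have hVm : ∀ z κ, gaugeAct (axialFn (perCfg P U) 0) (perCfg P U) z κ ∈ U1 𝔸 := gaugeAct_mem hUt (axialFn_mem hUt 0)
  rw [gaugeU_axialGaugeT_of_wrap P U x μ h, Units.val_mul, Units.val_mul, Units.val_mul]
  have hA := hol_mem hVm (liftSite (shift μ x)) (seg μ ((P μ - 1 : ℕ) : ℤ))
  have hA1 : ‖(((hol (gaugeAct (axialFn (perCfg P U) 0) (perCfg P U)) (liftSite (shift μ x)) (seg μ ((P μ - 1 : ℕ) : ℤ)))⁻¹ : 𝔸ˣ) : 𝔸)‖ ≤ 1 :=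
    (mem_U1.mp hA).2
  refine (B8Ineq170.norm_mul_sub_one_le_of_norm_le_one hA1).trans (add_le_add ?_ ?_)
  · exact (norm_inv_sub_one_le hA).trans (norm_hol_openLine_sub_one_le P hU hδ x μ h)
  · exact (norm_units_conj_sub_one_le (axialFn_mem hUt 0 _) _).trans hθ

omit [∀ i, NeZero (P i)] in
/-- The count behind print's `|b₋ − y|α₀ ≦ dLα₀`: `Σ_{κ<μ} x_κ ≤ d·(N − 1)` on the box `[0, P−1]^d ⊂ [0, N−1]^d`. [cite: Balaban1985Averaging, p.25] -/
theorem l1_lowPart_liftSite_le {N : ℕ} (hN : ∀ i, P i ≤ N) (x : TSite d P) (μ : Fin d) : (l1 (lowPart μ (liftSite x)) : ℝ) ≤ d * ((N : ℝ) - 1) := by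
  have hterm : ∀ κ, ((lowPart μ (liftSite x) κ).natAbs : ℝ) ≤ (N : ℝ) - 1 := by
    intro κ
    have hx := (x κ).isLt
    have hNκ := hN κ
    have h1 : (1 : ℝ) ≤ N := by exact_mod_cast (show 1 ≤ N by omega)
    simp only [lowPart_apply, liftSite]
    split_ifs
    · rw [Int.natAbs_natCast]
      have : ((x κ : ℕ) : ℝ) + 1 ≤ N := by exact_mod_cast (show (x κ : ℕ) + 1 ≤ N by omega)
      linarith
    · simp only [Int.natAbs_zero, Nat.cast_zero]; linarith
  calc (l1 (lowPart μ (liftSite x)) : ℝ) = ∑ κ, ((lowPart μ (liftSite x) κ).natAbs : ℝ) := by simp only [l1, Nat.cast_sum]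
    _ ≤ ∑ _κ : Fin d, ((N : ℝ) - 1) := Finset.sum_le_sum fun κ _ => hterm κ
    _ = d * ((N : ℝ) - 1) := by rw [Finset.sum_const, Finset.card_univ, Fintype.card_fin, nsmul_eq_mul]

include hU hδ in
/-- **THE UNIFORM FORM — SMALL PLAQUETTES AND SMALL CLOSED LINES ⇒ THE AXIAL GAUGE MAKES EVERY BOND SMALL**: for unit-bounded `U` on the torus
`TSite d P` with `P_i ≤ N`, all plaquette variables `δ`-close to `1` and all closed coordinate lines `θ`-close to `1`, EVERY bond of `U^g`,
`g = axialGaugeT P U`, satisfies `‖U^g(b) − 1‖ ≤ d(N − 1)²·δ + θ` (non-wrapping bonds: `≤ d(N−1)δ`; wrapping bonds: `≤ (N−1)·d(N−1)δ + θ`).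
This is print's (1.12) «there exists a G-valued gauge transformation u defined on □ and such that U^u = exp iξA, |A| < O(1)…α₀» for the cube □ = the
whole periodic lattice, in the group (no logarithm taken). [cite: Balaban1985Averaging, (44) p.24, pp.24–25; Balaban1987RG1, (1.11)–(1.12) p.262] -/
theorem norm_gaugeU_axialGaugeT_sub_one_le {N : ℕ} (hN : ∀ i, P i ≤ N) (hδ0 : 0 ≤ δ) {θ : ℝ} (hθ0 : 0 ≤ θ)
    (hθ : ∀ (x : TSite d P) (μ : Fin d), ‖((lineHolT P U x μ : 𝔸ˣ) : 𝔸) - 1‖ ≤ θ) (b : Bond d P) :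
    ‖((gaugeU (axialGaugeT P U) U b : 𝔸ˣ) : 𝔸) - 1‖ ≤ d * ((N : ℝ) - 1) ^ 2 * δ + θ := by
  obtain ⟨x, μ⟩ := b
  have hcnt := l1_lowPart_liftSite_le P hN x μ
  have hd0 : (0 : ℝ) ≤ d := Nat.cast_nonneg d
  have hxμ := (x μ).isLt
  have hN1 : (1 : ℝ) ≤ N := by exact_mod_cast (show 1 ≤ N from le_trans (NeZero.pos (P μ)) (hN μ))
  rcases Nat.lt_or_ge ((x μ : ℕ) + 1) (P μ) with h | h
  · -- non-wrapping bond: `N ≥ 2`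
    have hN2 : (2 : ℝ) ≤ N := by exact_mod_cast (show 2 ≤ N by have := hN μ; omega)
    refine (norm_gaugeU_axialGaugeT_sub_one_le_of_lt P hU hδ x μ h).trans ?_
    have h1 : (l1 (lowPart μ (liftSite x)) : ℝ) * δ ≤ d * ((N : ℝ) - 1) * δ := mul_le_mul_of_nonneg_right hcnt hδ0
    have h2 : d * ((N : ℝ) - 1) * δ ≤ d * ((N : ℝ) - 1) ^ 2 * δ := by
      have : d * ((N : ℝ) - 1) ≤ d * ((N : ℝ) - 1) ^ 2 := by nlinarith
      exact mul_le_mul_of_nonneg_right this hδ0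
    linarith
  · -- wrapping bond
    have hw : (x μ : ℕ) + 1 = P μ := le_antisymm hxμ h
    refine (norm_gaugeU_axialGaugeT_sub_one_le_of_wrap P hU hδ x μ hw (hθ _ _)).trans ?_
    have hP : ((P μ - 1 : ℕ) : ℝ) ≤ (N : ℝ) - 1 := by
      rw [Nat.cast_pred (NeZero.pos (P μ))]
      exact sub_le_sub_right (by exact_mod_cast hN μ) 1
    have hP0 : (0 : ℝ) ≤ ((P μ - 1 : ℕ) : ℝ) := Nat.cast_nonneg _
    have hl0 : (0 : ℝ) ≤ l1 (lowPart μ (liftSite x)) * δ := mul_nonneg (Nat.cast_nonneg _) hδ0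
    have h1 : ((P μ - 1 : ℕ) : ℝ) * (l1 (lowPart μ (liftSite x)) * δ) ≤ ((N : ℝ) - 1) * (d * ((N : ℝ) - 1) * δ) :=
      mul_le_mul hP (mul_le_mul_of_nonneg_right hcnt hδ0) hl0 (by linarith)
    nlinarith

end Bounds

end Literature.MathematicalPhysics.QuantumFieldTheory.Balaban1983to89.B7Eq44TorusAxialGauge

end
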